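import Summits.BirchSwinnertonDyer.Rank1Residual.ManinAdditive.ShimuraExponentAtTwo
import Summits.BirchSwinnertonDyer.BirchSwinnertonDyer.Theorems.ManinLocalTwoThreeShimuraQuotientLevelInstances
import HarnessLib

/-!
# The Shimura exponent at 2 — level sieves and profiles (cell bsd-f2-manin, es g42; MEMO-es §64.11–64.13)

Companion of `ShimuraExponentAtTwo.lean` (rows E-es-193m/211/212/213 and the inputs `hO`, `hE`).  Here:
* §6 the TOTIENT sieve (Ling–Oesterlé Thm 1, tree `totient_mul_mem_periodLatticeGamma1`): `p ∤ φ(N) ⟹ p ∤ [Λ₀:Λ₁]`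
  (every level), the profiles of an index divisible by `5` / by `3` (rows E-es-215 `FiveIndexProfile`, E-es-216
  `ThreeIndexProfile`);
* §7 the HALF-totient sieve (tree `half_totient_mul_mem_periodLatticeGamma1_mod`): R4♯ at odd `N = u²v`, `4 ∤ φ(uv)/2`;
  the PRIME-LEVEL Derickx–Orlić rung on the primes `q ≢ 1 (mod 8)`, `q ≢ 1 (mod 5)` (row E-es-214
  `PrimeLevelShimuraExponentLeThreeSieved`, proved from `hO` alone — no torsion classification);
* §8 the ADDITIVE prime `3`: `9 ∣ N ⟹` kernel `∈ {0, ℤ/3}` decided by the local invariant at `2`; `36 ∣ N ⟹ 0`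
  (row E-es-217 `NineLevelShimuraProfile`).

Falsifiers (cell pack HOME/es/g42/): E214 0 violations / 29 sieved prime-level classes (exponent > 3 at prime level only
`11a1`, `17a1` of 61); E215 residue census (258/329 odd-level classes `N ≥ 18` decided); E217 0/179 (`n = 3` exactly at
`27a1`, `54a1`).  All theorems are modulo `hO`/`hE` = tree theorems verbatim (discharge by name in a Theorems helper).
-/

set_option autoImplicit false

noncomputable section

open scoped MatrixGroups ModularForm

open CongruenceSubgroup Complex WeierstrassCurve Literature.NumberTheory.EllipticCurves
  Literature.NumberTheory.EllipticCurves.ModularForms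
open Summit.BirchSwinnertonDyer.Rank1Residual.ManinAdditive.KatoCurve

open Summit.BirchSwinnertonDyer.BirchSwinnertonDyer.Theorems.ManinLocalTwoThree.ShimuraIndexAtTwo
  (two_mul_mem_of_intCast_mul_mem three_mul_mem_of_intCast_mul_mem)
namespace Summit.BirchSwinnertonDyer.Rank1Residual.ManinAdditive.EsG42

/-! ## §6 — the level sieve (Ling–Oesterlé Thm 1: `φ(N)·Λ₀(f) ⊆ Λ₁(f)`, tree `totient_mul_mem_periodLatticeGamma1`)

Combined with the Eisenstein number at `2`: `5 ∣ [Λ₀:Λ₁]` needs `2 ∤ N`, `a₂(W) = −2` AND `5 ∣ φ(N)` (a prime `q ≡ 1 (mod 5)`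
divides `N`, or `25 ∣ N`); `3 ∣ [Λ₀:Λ₁]` needs `3 ∣ φ(N)`.  So R5♯ is PROVED at every level with `5 ∤ φ(N)`, and R4♯/R5♯ only
live on the levels that the sieve lets through. -/

/-- **Generic sieve (PROVED, every level, every weight-2 cusp form): a prime `p ∤ φ(N)` is prime to `[Λ₀(f):Λ₁(f)]`.**
[cite: LingOesterle1991, §1 and Thm. 1] -/
theorem shimuraIndexPrimeTo_of_not_dvd_totient {N : ℕ} [NeZero N] (f : CuspForm (Gamma0 N) 2) {p : ℕ} (hp : p.Prime)
    (h : ¬ p ∣ Nat.totient N) : ShimuraIndexPrimeTo p f := by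
  intro z hz hpz
  refine Summit.BirchSwinnertonDyer.BirchSwinnertonDyer.Theorems.ManinLocalTwoThree.mem_of_intCast_mul_mem_of_prime_mul_mem
    hp (m := (Nat.totient N : ℤ)) (by exact_mod_cast h) ?_ hpz
  exact_mod_cast Literature.NumberTheory.EllipticCurves.ModularForms.totient_mul_mem_periodLatticeGamma1 f hz

/-- **R5♯ on the sieved levels (PROVED, no hypothesis on `a₂`, no bound on `N`).** -/
theorem shimuraIndexPrimeTo_five_of_not_five_dvd_totient {N : ℕ} [NeZero N] (f : CuspForm (Gamma0 N) 2)
    (h : ¬ 5 ∣ Nat.totient N) : ShimuraIndexPrimeTo 5 f :=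
  shimuraIndexPrimeTo_of_not_dvd_totient f (by norm_num) h

/-- **The profile of a `5` in the Shimura index (PROVED modulo the two Eisenstein-at-2 inputs).**  If `5 ∣ [Λ₀(f):Λ₁(f)]` for the
newform of a globally minimal `W`, then the level is ODD, `a₂(W) = −2` (five points over `𝔽₂`) and `5 ∣ φ(N)`.  (With p3's
E-an-128ℓ `CuspLifting.shimuraOddPrimeForcesRationalTorsion_holds` on a lattice-optimal datum also `W(ℚ)[5] ≠ 0`, so
`W[5] ≅ ℤ/5 ⊕ μ₅` as for `X₀(11)`; with p3's `rootNumber_eq_one_of_ne` also `w(W) = +1`.) -/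
theorem profile_of_not_shimuraIndexPrimeTo_five (hO : OddLevelEisensteinAtTwo) (hE : EvenLevelEisensteinAtTwo)
    (W : WeierstrassCurve ℚ) [W.IsElliptic] [W.IsGloballyMinimal] {N : ℕ} [NeZero N] (D : ModularParametrizationData W N)
    (h5 : ¬ ShimuraIndexPrimeTo 5 D.f) :
    ¬ 2 ∣ N ∧ W.frobeniusTrace 2 = -2 ∧ 5 ∣ Nat.totient N := by
  have htot : 5 ∣ Nat.totient N := by
    by_contra h
    exact h5 (shimuraIndexPrimeTo_five_of_not_five_dvd_totient D.f h)
  have key : ∀ (c : ℤ), ¬ (5 : ℤ) ∣ c → (∀ z ∈ periodLattice D.f, (c : ℂ) * z ∈ periodLatticeGamma1 D.f) → False := by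
    intro c hc hmem
    refine h5 fun z hz h5z ↦ ?_
    exact Summit.BirchSwinnertonDyer.BirchSwinnertonDyer.Theorems.ManinLocalTwoThree.mem_of_intCast_mul_mem_of_prime_mul_mem
      (p := 5) (by norm_num) (m := c) (by exact_mod_cast hc) (hmem z hz) (by exact_mod_cast h5z)
  by_cases hN : 2 ∣ N
  · exfalso
    obtain ⟨e, he, hmem⟩ := hE D.f D.isNewformOf.1 hN
    exact key (e - 2) (by rcases he with rfl | rfl | rfl <;> decide) hmem
  · obtain ⟨habs, hmem⟩ := hO W D.f D.isNewformOf hN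
    obtain ⟨hlo, hhi⟩ := abs_le.mp habs
    refine ⟨hN, ?_, htot⟩
    by_contra ha
    exact key (W.frobeniusTrace 2 - 3) (by omega) hmem

/-- Likewise for `3`: `3 ∣ [Λ₀(f):Λ₁(f)]` forces `3 ∣ φ(N)` and (`2 ∤ N ∧ a₂(W) = 0`) ∨ (`2 ∣ N ∧ a₂(f) = −1`). -/
theorem profile_of_not_shimuraIndexPrimeTo_three (hO : OddLevelEisensteinAtTwo) (hE : EvenLevelEisensteinAtTwo)
    (W : WeierstrassCurve ℚ) [W.IsElliptic] [W.IsGloballyMinimal] {N : ℕ} [NeZero N] (D : ModularParametrizationData W N)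
    (h3 : ¬ ShimuraIndexPrimeTo 3 D.f) :
    3 ∣ Nat.totient N ∧ ((¬ 2 ∣ N ∧ W.frobeniusTrace 2 = 0) ∨
      (2 ∣ N ∧ ∀ z ∈ periodLattice D.f, ((-1 - 2 : ℤ) : ℂ) * z ∈ periodLatticeGamma1 D.f)) := by
  have htot : 3 ∣ Nat.totient N := by
    by_contra h
    exact h3 (shimuraIndexPrimeTo_of_not_dvd_totient D.f (by norm_num) h)
  have key : ∀ (c : ℤ), ¬ (3 : ℤ) ∣ c → (∀ z ∈ periodLattice D.f, (c : ℂ) * z ∈ periodLatticeGamma1 D.f) → False := by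
    intro c hc hmem
    refine h3 fun z hz h3z ↦ ?_
    exact Summit.BirchSwinnertonDyer.BirchSwinnertonDyer.Theorems.ManinLocalTwoThree.mem_of_intCast_mul_mem_of_prime_mul_mem
      (p := 3) (by norm_num) (m := c) (by exact_mod_cast hc) (hmem z hz) (by exact_mod_cast h3z)
  refine ⟨htot, ?_⟩
  by_cases hN : 2 ∣ N
  · obtain ⟨e, he, hmem⟩ := hE D.f D.isNewformOf.1 hN
    rcases he with rfl | rfl | rfl
    · exact (key (0 - 2) (by decide) hmem).elim
    · exact (key (1 - 2) (by decide) hmem).elim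
    · exact Or.inr ⟨hN, hmem⟩
  · obtain ⟨habs, hmem⟩ := hO W D.f D.isNewformOf hN
    obtain ⟨hlo, hhi⟩ := abs_le.mp habs
    refine Or.inl ⟨hN, ?_⟩
    by_contra ha
    exact key (W.frobeniusTrace 2 - 3) (by omega) hmem


/-! ## §7 — the HALF-totient sieve for the 2-part (Ling–Oesterlé Thm 1 in the sharp form `(φ(uv)/2)·Λ₀ ⊆ Λ₁`, `N = u²v`, `uv > 2`;
tree `ManinLocalTwoThree.half_totient_mul_mem_periodLatticeGamma1_mod`): R4♯ PROVED at every odd level admitting a factorisation with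
`4 ∤ φ(uv)/2`, and the PRIME-LEVEL Derickx–Orlić rung PROVED OUTRIGHT for `q ≢ 1 (mod 8)`, `q ≢ 1 (mod 5)` (no Miyawaki). -/

/-- **R4♯ on the half-totient-sieved levels (PROVED modulo the odd Eisenstein input).**  At odd level with `a₂(W) = −1`
(`4Λ₀ ⊆ Λ₁`), any factorisation `N = u²v`, `uv > 2`, with `4 ∤ φ(uv)/2` gives `2Λ₀(f) ⊆ Λ₁(f)`. -/
theorem two_mul_mem_of_not_four_dvd_half_totient (hO : OddLevelEisensteinAtTwo)
    (W : WeierstrassCurve ℚ) [W.IsElliptic] [W.IsGloballyMinimal] {N : ℕ} [NeZero N] (D : ModularParametrizationData W N)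
    (hN2 : ¬ 2 ∣ N) (ha : W.frobeniusTrace 2 = -1) {u v : ℕ} (hu : u ≠ 0) (hN : (N : ℤ) = (u : ℤ) ^ 2 * v)
    (huv : 2 < u * v) (h4 : ¬ 4 ∣ Nat.totient (u * v) / 2) :
    ∀ z ∈ periodLattice D.f, 2 * z ∈ periodLatticeGamma1 D.f := by
  intro z hz
  obtain ⟨-, hmem⟩ := hO W D.f D.isNewformOf hN2
  have h4z : ((2 : ℕ) : ℂ) * (2 * z) ∈ periodLatticeGamma1 D.f := by
    have h' := (periodLatticeGamma1 D.f).neg_mem (hmem z hz)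
    rw [ha] at h'
    convert h' using 1
    push_cast
    ring
  have hm := Summit.BirchSwinnertonDyer.BirchSwinnertonDyer.Theorems.ManinLocalTwoThree.half_totient_mul_mem_periodLatticeGamma1_mod
    D.f hu hN huv hz
  rcases Nat.even_or_odd (Nat.totient (u * v) / 2) with ⟨m', hm'⟩ | ⟨m', hm'⟩
  · -- `φ(uv)/2 = 2m'` with `m'` odd
    have hm'odd : ¬ (2 : ℤ) ∣ (m' : ℤ) := by
      intro h2
      obtain ⟨k, hk⟩ := h2
      apply h4
      omega
    have hm'w : ((m' : ℤ) : ℂ) * (2 * z) ∈ periodLatticeGamma1 D.f := by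
      convert hm using 1
      rw [hm']
      push_cast
      ring
    exact Summit.BirchSwinnertonDyer.BirchSwinnertonDyer.Theorems.ManinLocalTwoThree.mem_of_intCast_mul_mem_of_prime_mul_mem
      (p := 2) Nat.prime_two hm'odd hm'w h4z
  · -- `φ(uv)/2 = 2m' + 1` odd
    have hodd : ¬ (2 : ℤ) ∣ ((Nat.totient (u * v) / 2 : ℕ) : ℤ) := by
      intro h2
      obtain ⟨k, hk⟩ := h2
      omega
    have hmw : (((Nat.totient (u * v) / 2 : ℕ) : ℤ) : ℂ) * (2 * z) ∈ periodLatticeGamma1 D.f := by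
      have := (periodLatticeGamma1 D.f).add_mem hm hm
      convert this using 1
      rw [Int.cast_natCast]
      ring
    exact Summit.BirchSwinnertonDyer.BirchSwinnertonDyer.Theorems.ManinLocalTwoThree.mem_of_intCast_mul_mem_of_prime_mul_mem
      (p := 2) Nat.prime_two hodd hmw h4z

/-- **R4♯ at PRIME level `q ≢ 1 (mod 8)` (PROVED modulo the odd Eisenstein input):** `(q−1)/2 ≢ 0 (mod 4)`. -/
theorem two_mul_mem_primeLevel (hO : OddLevelEisensteinAtTwo)
    (W : WeierstrassCurve ℚ) [W.IsElliptic] [W.IsGloballyMinimal] {q : ℕ} [NeZero q] (D : ModularParametrizationData W q)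
    (hq : q.Prime) (hq3 : 3 ≤ q) (hq8 : q % 8 ≠ 1) (ha : W.frobeniusTrace 2 = -1) :
    ∀ z ∈ periodLattice D.f, 2 * z ∈ periodLatticeGamma1 D.f := by
  have hN2 : ¬ 2 ∣ q := by
    intro h
    have := (Nat.prime_dvd_prime_iff_eq Nat.prime_two hq).mp h
    omega
  refine two_mul_mem_of_not_four_dvd_half_totient hO W D hN2 ha (u := 1) (v := q) one_ne_zero (by push_cast; ring)
    (by omega) ?_
  rw [one_mul, Nat.totient_prime hq]
  omega

/-- **THE PRIME-LEVEL DERICKX–ORLIĆ RUNG, SIEVED, PROVED OUTRIGHT (modulo the odd Eisenstein input = tree theorem):** for a prime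
level `q ≥ 3` with `q ≢ 1 (mod 8)` and `q ≢ 1 (mod 5)`, every `X₀(q)`-datum of a globally minimal `W` has `2Λ₀(f) ⊆ Λ₁(f)` or
`3Λ₀(f) ⊆ Λ₁(f)` — no torsion classification (Miyawaki) needed; cf. §63.16 (all primes ⟸ Miyawaki). -/
theorem exponentLeThree_primeLevel_sieved (hO : OddLevelEisensteinAtTwo)
    (W : WeierstrassCurve ℚ) [W.IsElliptic] [W.IsGloballyMinimal] {q : ℕ} [NeZero q] (D : ModularParametrizationData W q)
    (hq : q.Prime) (hq3 : 3 ≤ q) (hq8 : q % 8 ≠ 1) (hq5 : q % 5 ≠ 1) :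
    (∀ z ∈ periodLattice D.f, 2 * z ∈ periodLatticeGamma1 D.f) ∨
      (∀ z ∈ periodLattice D.f, 3 * z ∈ periodLatticeGamma1 D.f) := by
  have hN2 : ¬ 2 ∣ q := by
    intro h
    have := (Nat.prime_dvd_prime_iff_eq Nat.prime_two hq).mp h
    omega
  obtain ⟨habs, hmem⟩ := hO W D.f D.isNewformOf hN2
  obtain ⟨hlo, hhi⟩ := abs_le.mp habs
  have hcases : W.frobeniusTrace 2 = -2 ∨ W.frobeniusTrace 2 = -1 ∨ W.frobeniusTrace 2 = 0 ∨
      W.frobeniusTrace 2 = 1 ∨ W.frobeniusTrace 2 = 2 := by omega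
  rcases hcases with ha | ha | ha | ha | ha
  · -- `a₂ = −2`: `5Λ₀ ⊆ Λ₁` and `5 ∤ φ(q) = q − 1`
    have h5 : ShimuraIndexPrimeTo 5 D.f := by
      refine shimuraIndexPrimeTo_five_of_not_five_dvd_totient D.f ?_
      rw [Nat.totient_prime hq]
      omega
    refine Or.inl fun z hz ↦ ?_
    have h5z : (5 : ℂ) * z ∈ periodLatticeGamma1 D.f := by
      have h' := (periodLatticeGamma1 D.f).neg_mem (hmem z hz)
      rw [ha] at h'
      convert h' using 1
      push_cast
      ring
    have hz1 : z ∈ periodLatticeGamma1 D.f := h5 z hz (by exact_mod_cast h5z)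
    convert (periodLatticeGamma1 D.f).add_mem hz1 hz1 using 1
    ring
  · exact Or.inl (two_mul_mem_primeLevel hO W D hq hq3 hq8 ha)
  · exact Or.inr fun z hz ↦ three_mul_mem_of_intCast_mul_mem (c := W.frobeniusTrace 2 - 3) (by omega) (hmem z hz)
  · exact Or.inl fun z hz ↦ two_mul_mem_of_intCast_mul_mem (c := W.frobeniusTrace 2 - 3) (by omega) (hmem z hz)
  · exact Or.inl fun z hz ↦ two_mul_mem_of_intCast_mul_mem (c := W.frobeniusTrace 2 - 3) (by omega) (hmem z hz)


/-- **E-es-214 `PrimeLevelShimuraExponentLeThreeSieved`** (the prime-level Derickx–Orlić rung E-es-205 on the sieved primes, minimal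
models; PROVED below modulo the odd Eisenstein input).  The sieve is sharp on the E15 table (61 prime-level classes, `q ≤ 18289`): the two prime levels with exponent `> 3` are
`q = 11 ≡ 1 (mod 5)` (index `5`) and `q = 17 ≡ 1 (mod 8)` (exponent `4`); falsifier E214: 0 violations / 29 sieved prime-level classes. [cite: DerickxOrlic2025, Rmk. 4.8] [cite: LingOesterle1991, Thm. 1 and Thm. 6] -/
@[conjecture]
def PrimeLevelShimuraExponentLeThreeSieved : Prop :=
  ∀ (W : WeierstrassCurve ℚ) [W.IsElliptic] [W.IsGloballyMinimal] {q : ℕ} [NeZero q] (D : ModularParametrizationData W q),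
    q.Prime → 3 ≤ q → q % 8 ≠ 1 → q % 5 ≠ 1 →
      (∀ z ∈ periodLattice D.f, 2 * z ∈ periodLatticeGamma1 D.f) ∨ (∀ z ∈ periodLattice D.f, 3 * z ∈ periodLatticeGamma1 D.f)

/-- E-es-214 ⟸ the odd Eisenstein input (tree theorem `ShimuraIndexAtTwo.oddLevelEisensteinAtTwo`). -/
theorem primeLevelShimuraExponentLeThreeSieved_of (hO : OddLevelEisensteinAtTwo) : PrimeLevelShimuraExponentLeThreeSieved :=
  fun W _ _ _ _ D hq hq3 hq8 hq5 ↦ exponentLeThree_primeLevel_sieved hO W D hq hq3 hq8 hq5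


/-- **E-es-215 `FiveIndexProfile`**: a `5` in the Shimura index forces odd level, `a₂(W) = −2` (`#W̃(𝔽₂) = 5`) and `5 ∣ φ(N)`.
PROVED below modulo the two Eisenstein inputs. [cite: LingOesterle1991, Thm. 1 and Thm. 6] -/
@[conjecture]
def FiveIndexProfile : Prop :=
  ∀ (W : WeierstrassCurve ℚ) [W.IsElliptic] [W.IsGloballyMinimal] {N : ℕ} [NeZero N] (D : ModularParametrizationData W N),
    ¬ ShimuraIndexPrimeTo 5 D.f → ¬ 2 ∣ N ∧ W.frobeniusTrace 2 = -2 ∧ 5 ∣ Nat.totient N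

/-- E-es-215 ⟸ the two Eisenstein inputs. -/
theorem fiveIndexProfile_of (hO : OddLevelEisensteinAtTwo) (hE : EvenLevelEisensteinAtTwo) : FiveIndexProfile :=
  fun W _ _ _ _ D h5 ↦ profile_of_not_shimuraIndexPrimeTo_five hO hE W D h5

/-- **E-es-216 `ThreeIndexProfile`**: a `3` in the Shimura index forces `3 ∣ φ(N)` and (odd level with `a₂(W) = 0`) or (even level
with `−3·Λ₀ ⊆ Λ₁`, i.e. `2 ∥ N`, `a₂(f) = −1`). PROVED below modulo the two Eisenstein inputs. [cite: LingOesterle1991, Thm. 1 and Thm. 6] -/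
@[conjecture]
def ThreeIndexProfile : Prop :=
  ∀ (W : WeierstrassCurve ℚ) [W.IsElliptic] [W.IsGloballyMinimal] {N : ℕ} [NeZero N] (D : ModularParametrizationData W N),
    ¬ ShimuraIndexPrimeTo 3 D.f → 3 ∣ Nat.totient N ∧
      ((¬ 2 ∣ N ∧ W.frobeniusTrace 2 = 0) ∨
        (2 ∣ N ∧ ∀ z ∈ periodLattice D.f, ((-1 - 2 : ℤ) : ℂ) * z ∈ periodLatticeGamma1 D.f))

/-- E-es-216 ⟸ the two Eisenstein inputs. -/
theorem threeIndexProfile_of (hO : OddLevelEisensteinAtTwo) (hE : EvenLevelEisensteinAtTwo) : ThreeIndexProfile :=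
  fun W _ _ _ _ D h3 ↦ profile_of_not_shimuraIndexPrimeTo_three hO hE W D h3



/-- **Row E-es-219** (`HalfTotientSievedNoFourTorsion`): R4♯ on the half-totient-sieved odd levels — `2 ∤ N = u²v`, `a₂(W) = −1`,
`uv > 2`, `4 ∤ φ(uv)/2` ⟹ `2Λ₀(f) ⊆ Λ₁(f)` (PROVED from `hO`: `halfTotientSievedNoFourTorsion_of`).
[cite: LingOesterle1991, Thm. 1 and Thm. 6] -/
@[conjecture]
def HalfTotientSievedNoFourTorsion : Prop :=
  ∀ (W : WeierstrassCurve ℚ) [W.IsElliptic] [W.IsGloballyMinimal] {N : ℕ} [NeZero N] (D : ModularParametrizationData W N),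
    ¬ 2 ∣ N → W.frobeniusTrace 2 = -1 → ∀ {u v : ℕ}, u ≠ 0 → (N : ℤ) = (u : ℤ) ^ 2 * v → 2 < u * v →
      ¬ 4 ∣ Nat.totient (u * v) / 2 → ∀ z ∈ periodLattice D.f, 2 * z ∈ periodLatticeGamma1 D.f

/-- E-es-219 ⟸ the odd Eisenstein input. -/
theorem halfTotientSievedNoFourTorsion_of (hO : OddLevelEisensteinAtTwo) : HalfTotientSievedNoFourTorsion :=
  fun W _ _ _ _ D hN2 ha _ _ hu hN huv h4 ↦ two_mul_mem_of_not_four_dvd_half_totient hO W D hN2 ha hu hN huv h4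

/-! ## §8 — the ADDITIVE prime `3` (`9 ∣ N`, in particular `27 ∣ N`): the Shimura kernel is `0` or `ℤ/3`, and `ℤ/3` is decided by
the LOCAL INVARIANT AT `2` — `#W̃(𝔽₂) = 3` at odd level, non-split multiplicative reduction (`a₂(f) = −1`) at `2 ∥ N`; `36 ∣ N ⟹ 0`.
(Tree: Atkin–Lehner `a₃ = 0` + Ling–Oesterlé `T₃ = 3` on `Σ(N)` = `pMulLatticeLeGamma1OfTracelessPrime_holds`; §6 profile.) -/

/-- tree two-liner: `p² ∣ N ⟹ p·Λ₀(f) ⊆ Λ₁(f)`. [cite: LingOesterle1991, Thm. 6] [cite: AtkinLehner1970, Thm. 3] -/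
theorem natCast_mul_mem_of_sq_dvd {N : ℕ} [NeZero N] (f : CuspForm (Gamma0 N) 2) (hf : IsNewform0 f) {p : ℕ} (hp : p.Prime)
    (h : p ^ 2 ∣ N) : ∀ z ∈ periodLattice f, (p : ℂ) * z ∈ periodLatticeGamma1 f :=
  pMulLatticeLeGamma1OfTracelessPrime_holds N f hf p hp ((dvd_pow_self p two_ne_zero).trans h)
    (hf.cuspCoeff_eq_zero_of_sq_dvd hp h)

/-- **`36 ∣ N ⟹ Λ₀(f) = Λ₁(f)`** (special case of the tree's two-traceless-primes law E-imc-21, recorded for the census). -/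
theorem mem_periodLatticeGamma1_of_thirtysix_dvd {N : ℕ} [NeZero N] (f : CuspForm (Gamma0 N) 2) (hf : IsNewform0 f)
    (h36 : 36 ∣ N) : ∀ z ∈ periodLattice f, z ∈ periodLatticeGamma1 f := by
  intro z hz
  have h3 := natCast_mul_mem_of_sq_dvd f hf Nat.prime_three (dvd_trans ⟨4, by norm_num⟩ h36) z hz
  have h2 := natCast_mul_mem_of_sq_dvd f hf Nat.prime_two (dvd_trans ⟨9, by norm_num⟩ h36) z hz
  have hz' : z = ((3 : ℕ) : ℂ) * z - ((2 : ℕ) : ℂ) * z := by push_cast; ring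
  rw [hz']
  exact (periodLatticeGamma1 f).sub_mem h3 h2

/-- **E-es-217 `NineLevelShimuraProfile`** (the cell's additive prime `3`): `9 ∣ N ⟹ 3Λ₀(f) ⊆ Λ₁(f)`, and if moreover
`Λ₀(f) ≠ Λ₁(f)` then `4 ∤ N` and (odd level with `a₂(W) = 0`) or (`2 ∥ N` with `−3Λ₀ ⊆ Λ₁`, i.e. `a₂(f) = −1`).
PROVED below modulo the two Eisenstein inputs. [cite: LingOesterle1991, Thm. 1 and Thm. 6] [cite: AtkinLehner1970, Thm. 3] -/
@[conjecture]
def NineLevelShimuraProfile : Prop :=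
  ∀ (W : WeierstrassCurve ℚ) [W.IsElliptic] [W.IsGloballyMinimal] {N : ℕ} [NeZero N] (D : ModularParametrizationData W N),
    9 ∣ N → (∀ z ∈ periodLattice D.f, (3 : ℂ) * z ∈ periodLatticeGamma1 D.f) ∧
      ((∃ x ∈ periodLattice D.f, x ∉ periodLatticeGamma1 D.f) →
        ¬ 4 ∣ N ∧ ((¬ 2 ∣ N ∧ W.frobeniusTrace 2 = 0) ∨
          (2 ∣ N ∧ ∀ z ∈ periodLattice D.f, ((-1 - 2 : ℤ) : ℂ) * z ∈ periodLatticeGamma1 D.f)))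

/-- E-es-217 ⟸ the two Eisenstein inputs. -/
theorem nineLevelShimuraProfile_of (hO : OddLevelEisensteinAtTwo) (hE : EvenLevelEisensteinAtTwo) : NineLevelShimuraProfile := by
  intro W _ _ N _ D h9
  have h3 : ∀ z ∈ periodLattice D.f, (3 : ℂ) * z ∈ periodLatticeGamma1 D.f := by
    intro z hz
    exact_mod_cast natCast_mul_mem_of_sq_dvd D.f D.isNewformOf.1 Nat.prime_three (by simpa using h9) z hz
  refine ⟨h3, fun ⟨x, hx, hx1⟩ ↦ ?_⟩
  have hn3 : ¬ ShimuraIndexPrimeTo 3 D.f := fun h ↦ hx1 (h x hx (by exact_mod_cast h3 x hx))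
  obtain ⟨-, hprof⟩ := profile_of_not_shimuraIndexPrimeTo_three hO hE W D hn3
  exact ⟨fun h4 ↦ hx1 (mem_periodLatticeGamma1_of_thirtysix_dvd D.f D.isNewformOf.1
    (Nat.Coprime.mul_dvd_of_dvd_of_dvd (by norm_num) h4 h9) x hx), hprof⟩


end Summit.BirchSwinnertonDyer.Rank1Residual.ManinAdditive.EsG42
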